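import Mathlib
import HarnessLib
import Literature.MathematicalPhysics.KineticTheory.VelocityFlipNoise
import Summits.AtomisticToContinuum.FouriersLaw.Theorems.VanishingNoiseTransferVanishingNoiseBoundNoisyKuboLink

/-!
# Stub S3 `stub_noisyPositiveConductance` from a classical forward field of the flip-noisy generator

`--supports stmt-AtomisticToContinuum-11976` helper file (crux `VanishingNoiseBound`, route
`VanishingNoiseTransfer`, line `fekete-usc-one-length`, stub S3 `stub_noisyPositiveConductance`, wave 3).
The CONDITIONAL form of stub S3: along the unique flip-steady family of the pinned anharmonic chain (all parameters
`> 0`, `T > 0`, flip rate `ε > 0`), the response `D_L(ε)` is POSITIVE for `L ≥ 2` as soon as the flip-noisy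
equilibrium generator `L_{T,T} + εS` has a classical exponentially bounded forward field `g` of the left bath
(`(L_{T,T} + εS) g = −(p_0² − T)`, `g` smooth, `|g|, |∂_{p_b} g|, |∂²_{p_b} g| ≤ C₁ e^{ϑ₁H}` at the contacts,
`0 < ϑ₁`, `2ϑ₁ < 1/T`):

* `flip_response_pos_of_forwardField` — `0 < D_L`: the mixing-free Kubo link `D_L/(L−1) = γ(1 − (γ/T²)⟨g, k_0⟩)`
  (`flip_kuboLink_of_forwardField`, `…NoisyKuboLink`) and the Onsager sign `0 < γ(1 − (γ/T²)⟨g, k_0⟩) ≤ γ`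
  (`flipKubo_pos_and_le`, `…FlipKuboOnsager`).
* `noisyPositiveConductance_of_flipForwardFields` — **stub S3 VERBATIM behind the single hypothesis `FF(ε)`**
  (existence of such forward fields for all admissible parameters, `T > 0`, `ε > 0`, `L ≥ 2`). The MILD forward
  field `g_ε = R_{Nε}((Nε)⁻¹(p_0² − T) + Q g_ε)` EXISTS, measurable with `|g_ε| ≤ C e^{H/(4T)}`
  (`flip_mildForwardField_exists`, `…FlipMildForwardField`, Harris for the embedded flip chain); so `FF(ε)` is the
  hypoelliptic `C²`-regularity with exponential contact-gradient bounds of that object for the NONLOCAL generator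
  `L + εS` — the `ε > 0` twin of the landed `forwardField_contDiff` / `forwardField_abs_le_exp` (crux 11749, via
  Hörmander's theorem for the DIFFERENTIAL operator `L`) plus the open contact-gradient bound `CG` of that crux;
  not in the tree and not covered by its Hörmander statement.
* `helper_noisyPositiveConductanceOfForwardField` — registered helper (notation-free restatement of
  `flip_response_pos_of_forwardField`).

References: Bonetto–Lebowitz–Rey-Bellet 2000, eq. (32); Rey-Bellet 2003, Rem. 4.4; Bernardin–Olla 2011 §2.1, §6.
-/

noncomputable section

open MeasureTheory Filter Topology Set ProbabilityTheory
open scoped ContDiff NNReal ENNReal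
open Literature.MathematicalPhysics.KineticTheory.HeatConduction
open Summit.AtomisticToContinuum.FouriersLaw.Theorems.SuperadditiveResistance.DeviceLiouville (kin kin_eq_sq)
open Summit.AtomisticToContinuum.FouriersLaw.Cruxes.ConductanceLowerBound.ForecastSensitivity (memLp_two_of_abs_le_exp)

namespace Summit.AtomisticToContinuum.FouriersLaw.Theorems.VanishingNoiseBound

section Positivity

variable {ω₂ lam β γ : ℝ}

/-- **Positivity of the flip-noisy response from a classical forward field**: under the hypotheses of
`flip_kuboLink_of_forwardField`, `0 < D_L` (`flipKubo_pos_and_le`: `D_L/(L−1) = G_L(ε) > 0`). -/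
theorem flip_response_pos_of_forwardField
    (μ : (N : ℕ) → ℝ → ℝ → Measure (PhaseSpace N)) {T ε : ℝ} (D : ℕ → ℝ)
    (hω : 0 < ω₂) (hl : 0 < lam) (hβ : 0 < β) (hγ : 0 < γ) (hT : 0 < T) (hε : 0 < ε)
    (hμ : ∀ (N : ℕ) (T_L T_R : ℝ), 0 < T_L → 0 < T_R →
      (pinnedChain ω₂ lam β γ).IsFlipSteadyState N T_L T_R ε (μ N T_L T_R) ∧
        ∀ ν : Measure (PhaseSpace N), (pinnedChain ω₂ lam β γ).IsFlipSteadyState N T_L T_R ε ν → ν = μ N T_L T_R)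
    {L : ℕ} (hL2 : 2 ≤ L)
    (hD : Tendsto (fun δ : ℝ =>
        (pinnedChain ω₂ lam β γ).totalCurrent (μ L (T + δ / 2) (T - δ / 2)) / δ) (𝓝[≠] 0) (𝓝 (D L)))
    {g : PhaseSpace L → ℝ} (hgs : ContDiff ℝ ((⊤ : ℕ∞) : WithTop ℕ∞) g)
    (hpde : ∀ x, (pinnedChain ω₂ lam β γ).flipGenerator L T T ε g x = -(kin L 0 x - T))
    {C₁ ϑ₁ : ℝ} (hϑ₁ : 0 < ϑ₁) (h2ϑ₁ : 2 * ϑ₁ < 1 / T)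
    (hgb0 : ∀ x, |g x| ≤ C₁ * Real.exp (ϑ₁ * (pinnedChain ω₂ lam β γ).hamiltonian L x))
    (hgrad : ∀ x,
      |partialP (⟨0, by omega⟩ : Fin L) g x| ≤ C₁ * Real.exp (ϑ₁ * (pinnedChain ω₂ lam β γ).hamiltonian L x) ∧
      |partialP (⟨L - 1, by omega⟩ : Fin L) g x| ≤
        C₁ * Real.exp (ϑ₁ * (pinnedChain ω₂ lam β γ).hamiltonian L x) ∧
      |partialP (⟨0, by omega⟩ : Fin L) (partialP (⟨0, by omega⟩ : Fin L) g) x| ≤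
        C₁ * Real.exp (ϑ₁ * (pinnedChain ω₂ lam β γ).hamiltonian L x) ∧
      |partialP (⟨L - 1, by omega⟩ : Fin L) (partialP (⟨L - 1, by omega⟩ : Fin L) g) x| ≤
        C₁ * Real.exp (ϑ₁ * (pinnedChain ω₂ lam β γ).hamiltonian L x)) :
    0 < D L := by
  have hlink := flip_kuboLink_of_forwardField μ D hω hl hβ hγ hT hε hμ hL2 hD hgs hpde hϑ₁ h2ϑ₁ hgb0 hgrad
  have hC : ContDiff ℝ 2 g := hgs.of_le (by norm_cast)
  have hgL2 : MemLp g 2 ((pinnedChain ω₂ lam β γ).gibbsMeasure L T) :=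
    memLp_two_of_abs_le_exp hω hl.le hβ.le γ L hT h2ϑ₁ hC.continuous hgb0
  have hpos := (flipKubo_pos_and_le hω hl hβ hγ hT hε.le hL2 hC hgL2 hpde).1
  rw [← hlink] at hpos
  have hL1r : 0 < ((L : ℝ) - 1) := by
    have : (2 : ℝ) ≤ (L : ℝ) := by exact_mod_cast hL2
    linarith
  have := mul_pos hpos hL1r
  rwa [div_mul_cancel₀ _ hL1r.ne'] at this

end Positivity

/-! ## Stub S3 behind the single equilibrium regularity hypothesis `FF(ε)` -/

/-- **Stub S3 `stub_noisyPositiveConductance` VERBATIM behind ONE hypothesis** `FF(ε)`: existence, for all admissible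
parameters, `T > 0`, `ε > 0` and `L ≥ 2`, of a classical (smooth) forward field `g` of the flip-noisy equilibrium
generator, `(L_{T,T} + εS) g = −(p_0² − T)`, with `|g|`, `|∂_{p_b} g|`, `|∂²_{p_b} g| ≤ C₁ e^{ϑ₁H}` at the contacts
(`0 < ϑ₁`, `2ϑ₁ < 1/T`). Then every finite noisy chain conducts: `D_N(ε) > 0` for `N ≥ 2` along the unique
flip-steady family (`flip_response_pos_of_forwardField`). -/
theorem noisyPositiveConductance_of_flipForwardFields :
    (∀ (ω₂ lam β γ T ε : ℝ), 0 < ω₂ → 0 < lam → 0 < β → 0 < γ → 0 < T → 0 < ε → ∀ (L : ℕ) (hL : 2 ≤ L),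
      ∃ (g : PhaseSpace L → ℝ) (C₁ ϑ₁ : ℝ), ContDiff ℝ ((⊤ : ℕ∞) : WithTop ℕ∞) g ∧ 0 < ϑ₁ ∧ 2 * ϑ₁ < 1 / T ∧
        (∀ x, (pinnedChain ω₂ lam β γ).flipGenerator L T T ε g x = -(kin L 0 x - T)) ∧
        ∀ x, |g x| ≤ C₁ * Real.exp (ϑ₁ * (pinnedChain ω₂ lam β γ).hamiltonian L x) ∧
          |partialP (⟨0, by omega⟩ : Fin L) g x| ≤ C₁ * Real.exp (ϑ₁ * (pinnedChain ω₂ lam β γ).hamiltonian L x) ∧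
          |partialP (⟨L - 1, by omega⟩ : Fin L) g x| ≤
            C₁ * Real.exp (ϑ₁ * (pinnedChain ω₂ lam β γ).hamiltonian L x) ∧
          |partialP (⟨0, by omega⟩ : Fin L) (partialP (⟨0, by omega⟩ : Fin L) g) x| ≤
            C₁ * Real.exp (ϑ₁ * (pinnedChain ω₂ lam β γ).hamiltonian L x) ∧
          |partialP (⟨L - 1, by omega⟩ : Fin L) (partialP (⟨L - 1, by omega⟩ : Fin L) g) x| ≤
            C₁ * Real.exp (ϑ₁ * (pinnedChain ω₂ lam β γ).hamiltonian L x)) →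
    ∀ ω₂ lam β γ : ℝ, 0 < ω₂ → 0 < lam → 0 < β → 0 < γ → ∀ T : ℝ, 0 < T → ∀ ε : ℝ, 0 < ε →
      ∀ μ : (N : ℕ) → ℝ → ℝ → Measure (PhaseSpace N),
        (∀ (N : ℕ) (T_L T_R : ℝ), 0 < T_L → 0 < T_R →
          (pinnedChain ω₂ lam β γ).IsFlipSteadyState N T_L T_R ε (μ N T_L T_R) ∧
            ∀ ν : Measure (PhaseSpace N),
              (pinnedChain ω₂ lam β γ).IsFlipSteadyState N T_L T_R ε ν → ν = μ N T_L T_R) →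
        ∀ D : ℕ → ℝ,
          (∀ N : ℕ, Tendsto (fun δ : ℝ =>
            (pinnedChain ω₂ lam β γ).totalCurrent (μ N (T + δ / 2) (T - δ / 2)) / δ)
            (𝓝[≠] 0) (𝓝 (D N))) →
          ∀ N : ℕ, 2 ≤ N → 0 < D N := by
  intro hFF ω₂ lam β γ hω hl hβ hγ T hT ε hε μ hμ D hD N hN
  obtain ⟨g, C₁, ϑ₁, hgs, hϑ₁, h2ϑ₁, hpde, hbd⟩ := hFF ω₂ lam β γ T ε hω hl hβ hγ hT hε N hN
  exact flip_response_pos_of_forwardField μ D hω hl hβ hγ hT hε hμ hN (hD N) hgs hpde hϑ₁ h2ϑ₁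
    (fun x => (hbd x).1) (fun x => (hbd x).2)


/-! ## Registered helper -/

/-- Registered helper sub-goal `helper_noisyPositiveConductanceOfForwardField` of stub `stub_noisyPositiveConductance`
(line `fekete-usc-one-length`, crux stmt-AtomisticToContinuum-11976): `0 < D_L(ε)` along the unique flip-steady family
given a classical exponentially bounded forward field of `L_{T,T} + εS` (`flip_response_pos_of_forwardField`). -/
theorem helper_noisyPositiveConductanceOfForwardField : ∀ (ω₂ lam β γ : ℝ) (μ : (N : ℕ) → ℝ → ℝ → MeasureTheory.Measure (Literature.MathematicalPhysics.KineticTheory.HeatConduction.PhaseSpace N)) (T ε : ℝ) (D : ℕ → ℝ), 0 < ω₂ → 0 < lam → 0 < β → 0 < γ → 0 < T → 0 < ε → (∀ (N : ℕ) (T_L T_R : ℝ), 0 < T_L → 0 < T_R → (Literature.MathematicalPhysics.KineticTheory.HeatConduction.pinnedChain ω₂ lam β γ).IsFlipSteadyState N T_L T_R ε (μ N T_L T_R) ∧ ∀ ν : MeasureTheory.Measure (Literature.MathematicalPhysics.KineticTheory.HeatConduction.PhaseSpace N), (Literature.MathematicalPhysics.KineticTheory.HeatConduction.pinnedChain ω₂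 lam β γ).IsFlipSteadyState N T_L T_R ε ν → ν = μ N T_L T_R) → ∀ (L : ℕ) (hL : 2 ≤ L), Filter.Tendsto (fun δ : ℝ => (Literature.MathematicalPhysics.KineticTheory.HeatConduction.pinnedChain ω₂ lam β γ).totalCurrent (μ L (T + δ / 2) (T - δ / 2)) / δ) (nhdsWithin 0 {(0 : ℝ)}ᶜ) (nhds (D L)) → ∀ (g : Literature.MathematicalPhysics.KineticTheory.HeatConduction.PhaseSpace L → ℝ), ContDiff ℝ ((⊤ : ℕ∞) : WithTop ℕ∞) g → (∀ x, (Literature.MathematicalPhysics.KineticTheory.HeatConduction.pinnedChain ω₂ lam β γ).flipGenerator L T T ε g x = -(Summit.AtomisticToContinuum.FouriersLaw.Theorems.SuperadditiveResistance.DeviceLiouville.kin L 0 x - T)) → ∀ (C₁ ϑ₁ : ℝ), 0 < ϑ₁ → 2 * ϑ₁ < 1 / T → (∀ x, |g x| ≤ C₁ * Real.exp (ϑ₁ * (Literature.MathematicalPhysics.KineticTheory.HeatConduction.pinnedChain ω₂ lam β γ).hamiltonian L x)) → (∀ x, |Literature.MathematicalPhysics.KineticTheory.HeatConduction.partialP (⟨0,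 by omega⟩ : Fin L) g x| ≤ C₁ * Real.exp (ϑ₁ * (Literature.MathematicalPhysics.KineticTheory.HeatConduction.pinnedChain ω₂ lam β γ).hamiltonian L x) ∧ |Literature.MathematicalPhysics.KineticTheory.HeatConduction.partialP (⟨L - 1, by omega⟩ : Fin L) g x| ≤ C₁ * Real.exp (ϑ₁ * (Literature.MathematicalPhysics.KineticTheory.HeatConduction.pinnedChain ω₂ lam β γ).hamiltonian L x) ∧ |Literature.MathematicalPhysics.KineticTheory.HeatConduction.partialP (⟨0, by omega⟩ : Fin L) (Literature.MathematicalPhysics.KineticTheory.HeatConduction.partialP (⟨0, by omega⟩ : Fin L) g) x| ≤ C₁ * Real.exp (ϑ₁ * (Literature.MathematicalPhysics.KineticTheory.HeatConduction.pinnedChain ω₂ lam β γ).hamiltonian L x) ∧ |Literature.MathematicalPhysics.KineticTheory.HeatConduction.partialP (⟨L - 1, by omega⟩ : Fin L) (Literature.MathematicalPhysics.KineticTheory.HeatConduction.partialP (⟨L - 1, by omega⟩ : Fin L) g) x| ≤ C₁ * Real.exp (ϑ₁ * (Literature.MathematicalPhysics.KineticTheory.HeatConduction.pinnedChain ω₂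 lam β γ).hamiltonian L x)) → 0 < D L :=
  fun _ _ _ _ μ _ _ D hω hl hβ hγ hT hε hμ _ hL hD _ hgs hpde _ _ hϑ₁ h2ϑ₁ hgb0 hgrad =>
    flip_response_pos_of_forwardField μ D hω hl hβ hγ hT hε hμ hL hD hgs hpde hϑ₁ h2ϑ₁ hgb0 hgrad

end Summit.AtomisticToContinuum.FouriersLaw.Theorems.VanishingNoiseBound

end
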